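import Summits.BirchSwinnertonDyer.Rank1Residual.X1.RankOneCoefficientCertificate
import Literature.NumberTheory.EllipticCurves.Rank1Residual.X1CoeffOneRiemannSumCertificate
import HarnessLib

/-!
# Residual class X1 ∩ {r = 1}: the per-pair route in RIEMANN-SUM currency —
# measure bound + ONE Riemann sum of `μ_{f,α}` beating the truncation bound + `p ∤ #Ш_an`
# ⇒ Mazur's main conjecture ∧ `BSD(E,p)` on the rank-one leaf (theorems only; no def, no fact)

HONEST FRAMING (cell `b2b-bsdres`, run/shared/lean/b2b/bsd-rank1-residual/, verbatim in every
file): the goal of the cell is to DELETE the COMBINATION-SHAPED residual classes of the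
Birch–Swinnerton-Dyer formula for ALL analytic-rank `≤ 1` elliptic curves over `ℚ` — "full BSD
formula for every rank `≤ 1` curve in class `C`" assembled STRICTLY from published theorems — so
that the rank-`≤ 1` remainder becomes exactly the CONSTRUCTION-SHAPED classes, which are TYPED
(missing-input `Prop`s), NOT attempted. This is not "finishing BSD". Lane CLASS-CLOSURE
(coordinator ruling 2026-08-21T04:07:19Z): research routes; no claim beyond the stated classes;
census / instrument output is EVIDENCE, never a Literature fact; per-pair certificates are
INSTRUMENTATION (E4), never coverage. PER-PAIR certificate shape, not a class theorem; nothing is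
booked by this file; no label of `RESIDUAL-MAP.md` moves. Seat cc-typer-6 GEN 7 (typer of record
N1 / N1′ / N1″; pen of the N1-COEFF1 register `HOME/class-closure/N1/PREDICTIONS-N1COEFF1.md`);
the class-level owner of X1 ∩ {r = 1} is the x1a lineage, whose `X1/RankOneCoefficientCertificate.lean`
(gen 10) this file extends BY NAME without touching it.

## What is here

x1a's `Leaf.bsdp_of_shaAn_unit_of_coeff_one_ne_zero` (and its isogeny booking form) take the
binder `hcoeff : coeff 1 (padicLFunction f (unitRoot W p : ℚ_[p])) ≠ 0` — "a `p`-adic `L`-series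
computation to finite precision". The tree now proves the finite-precision step itself
(`Literature/…/Rank1Residual/X1CoeffOneRiemannSumCertificate.lean`, this seat, on crux-0490's
`PAdicLFunctionRiemannSumCertificateProofs`): a uniform bound `‖μ_{f,α}(a + pᵐℤ_p)‖ ≤ C` for the
Mazur–Swinnerton-Dyer measure of `f` and its unit root, and ONE level `n` with
`C·p⁻ⁿ < ‖RS(1, n)‖` (`RS(1, n) = padicLRiemannSum f α 1 n`, an exact finite sum of plus-symbol
values), give `hcoeff` (`coeff_one_padicLFunction_ne_zero_of_riemannSum_certificate`; the
distribution relation is the unconditional `msdMeasure_distribution_of_isNewformOf`). This file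
composes the two:

* `Leaf.schneider_of_riemannSum_certificate` — leaf pair + (C, n, RS-inequality) ⇒ Schneider for
  every canonical height datum (Perrin-Riou `hPR`, GZK `hGZK`);
* `Leaf.mazurMainConjecture_and_bsdp_of_shaAn_unit_of_riemannSum_certificate` /
  `Leaf.bsdp_of_shaAn_unit_of_riemannSum_certificate` — + `p ∤ #Ш(E)_an` ⇒ Mazur's main
  conjecture ∧ `BSD(E,p)` (route B: Wuthrich 2014 Thm. 16, Schneider 1985 / BMS 1.7, Perrin-Riou
  1987, Mazur–Tate sigma, modularity, GZK — the PUBLISHED binders of x1a's theorem, unchanged);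
* `Leaf.bsdp_of_riemannSum_certificate_of_isIsogenous_shaAn_unit` — booking form along the
  isogeny class (`p ∤ #Ш(E′)_an` for SOME `E′ ∼ E`; Cassels).

What a row of the N1-COEFF1 instrument (two symbol engines × two folds, verdict `NON-ZERO(v)` at
level `n* = n + 1`, `K = n* − 1 − c_den > v`) supplies is EVIDENCE for `hlt` with `C = p^{c_den}`
in the engines' `ω₁`-normalisation (`x⁺_E = u_E·[·]⁺_f`; the pair (`hC`, `hlt`) is covariant under
the scale `u_E`) and for `hC` on the delivered levels; `hC` at ALL levels is Manin–Drinfeld's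
common denominator (`exists_norm_msdMeasure_le_of_isNewformOf`), explicit only case by case. The
isogenous-`Ш_an`-unit input is the obsanat column `ord_p_sha_min_class = 0` (census, EVIDENCE).
Nothing is discharged by this file; no cell changes colour.

References: [SteinWuthrich2013] §3 Prop. 3.1 / 3.5; [Wuthrich2014] Thm. 16; [PerrinRiou1987]
§1.4 Cor. 1.8; [BalakrishnanMullerStein2015] Thm. 1.7; [MilneADT2006] Thm. I.7.3.
-/

noncomputable section

open scoped Classical MatrixGroups ModularForm

open CongruenceSubgroup WeierstrassCurve PowerSeries Literature.NumberTheory.EllipticCurves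
  Literature.NumberTheory.EllipticCurves.ModularForms
  Literature.NumberTheory.EllipticCurves.Wuthrich2014
  Literature.NumberTheory.EllipticCurves.Rank1Residual
  Summit.BirchSwinnertonDyer.BirchSwinnertonDyer.Theorems
  Summit.BirchSwinnertonDyer.BirchSwinnertonDyer.Theorems.Rank1ResidualX1Defs

set_option autoImplicit false

namespace Summit.BirchSwinnertonDyer.Rank1Residual.X1.RankOne

variable {W : WeierstrassCurve ℚ} [W.IsElliptic] [W.IsGloballyMinimal] {p : ℕ} [Fact p.Prime]

/-- **Leaf pair + Riemann-sum certificate ⇒ Schneider.** At a rank-one X1 leaf pair, `f` the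
newform of `E`: a measure bound `C` (all levels) and ONE level `n` with `C·p⁻ⁿ < ‖RS(1, n)‖` give
`[T¹]L_p(f, α) ≠ 0` (`coeff_one_padicLFunction_ne_zero_of_riemannSum_certificate`), hence Schneider's
non-degeneracy for every canonical height datum (`Leaf.schneider_of_coeff_one_ne_zero`).
[cite: SteinWuthrich2013, §3 Prop. 3.5] [cite: PerrinRiou1987, §1.4 Cor. 1.8] -/
theorem Leaf.schneider_of_riemannSum_certificate (hPR : perrinRiou_rankOne_leadingTerms_odd)
    (hGZK : rank_eq_analyticRank_of_analyticRank_le_one) (h : Leaf W p) {N : ℕ} [NeZero N]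
    (f : CuspForm (Gamma0 N) 2) (hf : IsNewformOf W f) {C : ℝ}
    (hC : ∀ (m : ℕ) (a : ZMod (p ^ m)), ‖msdMeasure f (unitRoot W p : ℚ_[p]) m a‖ ≤ C) {n : ℕ}
    (hlt : C * (p : ℝ) ^ (-n : ℤ) < ‖padicLRiemannSum f (unitRoot W p : ℚ_[p]) 1 n‖) :
    ∀ Dh : PAdicHeightData W p, Dh.IsCanonical → SchneiderConjecture Dh :=
  h.schneider_of_coeff_one_ne_zero hPR hGZK f hf
    (coeff_one_padicLFunction_ne_zero_of_riemannSum_certificate h.isOrdinaryAt hf hC hlt)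

/-- **Per pair, Riemann-sum currency: `p ∤ #Ш(E/ℚ)_an` + (C, n, RS-inequality) ⇒ BOTH Mazur's main
conjecture and `BSD(E,p)`** at a leaf pair of either type — x1a's
`Leaf.mazurMainConjecture_and_bsdp_of_shaAn_unit_of_coeff_one_ne_zero` with `hcoeff` supplied by the
tree's truncation bound. PUBLISHED binders only (Wuthrich Thm. 16, Perrin-Riou–Schneider, Perrin-Riou
1987, Mazur–Tate sigma, modularity, GZK). [cite: Wuthrich2014, Thm. 16 (p. 397)]
[cite: BalakrishnanMullerStein2015, Thm. 1.7] [cite: PerrinRiou1987, §1.4 Cor. 1.8]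
[cite: SteinWuthrich2013, §3 Prop. 3.5] [cite: Miller2011LMS, Def. 1.1 (arXiv:1010.2431 p. 3)] -/
theorem Leaf.mazurMainConjecture_and_bsdp_of_shaAn_unit_of_riemannSum_certificate
    (hW16 : Wuthrich2014.charIdeal_dvd_padicLFunction) (hS : Schneider1985_order_charGenerator_odd)
    (hPR : perrinRiou_rankOne_leadingTerms_odd) (hMT : mazur_tate_sigma_exists_odd)
    (hmod : nonempty_modularParametrizationData) (hGZK : rank_eq_analyticRank_of_analyticRank_le_one)
    (h : Leaf W p) {N : ℕ} [NeZero N] (f : CuspForm (Gamma0 N) 2) (hf : IsNewformOf W f) {C : ℝ}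
    (hC : ∀ (m : ℕ) (a : ZMod (p ^ m)), ‖msdMeasure f (unitRoot W p : ℚ_[p]) m a‖ ≤ C) {n : ℕ}
    (hlt : C * (p : ℝ) ^ (-n : ℤ) < ‖padicLRiemannSum f (unitRoot W p : ℚ_[p]) 1 n‖)
    (hunit : ∃ q : ℚ, shaAn W = (q : ℂ) ∧ padicValRat p q = 0) :
    MazurMainConjecture W p ∧ BSDp W p :=
  h.mazurMainConjecture_and_bsdp_of_shaAn_unit_of_coeff_one_ne_zero hW16 hS hPR hMT hmod hGZK f hf
    (coeff_one_padicLFunction_ne_zero_of_riemannSum_certificate h.isOrdinaryAt hf hC hlt) hunit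

/-- **`BSD(E,p)` half** of the preceding theorem. [cite: Wuthrich2014, Thm. 16 (p. 397)]
[cite: PerrinRiou1987, §1.4 Cor. 1.8] [cite: SteinWuthrich2013, §3 Prop. 3.5] -/
theorem Leaf.bsdp_of_shaAn_unit_of_riemannSum_certificate
    (hW16 : Wuthrich2014.charIdeal_dvd_padicLFunction) (hS : Schneider1985_order_charGenerator_odd)
    (hPR : perrinRiou_rankOne_leadingTerms_odd) (hMT : mazur_tate_sigma_exists_odd)
    (hmod : nonempty_modularParametrizationData) (hGZK : rank_eq_analyticRank_of_analyticRank_le_one)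
    (h : Leaf W p) {N : ℕ} [NeZero N] (f : CuspForm (Gamma0 N) 2) (hf : IsNewformOf W f) {C : ℝ}
    (hC : ∀ (m : ℕ) (a : ZMod (p ^ m)), ‖msdMeasure f (unitRoot W p : ℚ_[p]) m a‖ ≤ C) {n : ℕ}
    (hlt : C * (p : ℝ) ^ (-n : ℤ) < ‖padicLRiemannSum f (unitRoot W p : ℚ_[p]) 1 n‖)
    (hunit : ∃ q : ℚ, shaAn W = (q : ℂ) ∧ padicValRat p q = 0) : BSDp W p :=
  (h.mazurMainConjecture_and_bsdp_of_shaAn_unit_of_riemannSum_certificate hW16 hS hPR hMT hmod hGZK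
    f hf hC hlt hunit).2

/-- **Booking form along the isogeny class, Riemann-sum currency:** leaf pair `(E, p)`, a
Riemann-sum certificate (C, n) for a newform `f` of `E`, and `p ∤ #Ш(E′)_an` for SOME globally
minimal `E′ ∼ E` ⇒ `BSD(E,p)` — x1a's `Leaf.bsdp_of_coeff_one_ne_zero_of_isIsogenous_shaAn_unit`
(Cassels: the BSD quotient is an isogeny invariant) with `hcoeff` from the truncation bound.
[cite: Wuthrich2014, Thm. 16 (p. 397)] [cite: PerrinRiou1987, §1.4 Cor. 1.8]
[cite: MilneADT2006, Thm. I.7.3] [cite: SteinWuthrich2013, §3 Prop. 3.5] -/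
theorem Leaf.bsdp_of_riemannSum_certificate_of_isIsogenous_shaAn_unit
    (hW16 : Wuthrich2014.charIdeal_dvd_padicLFunction) (hS : Schneider1985_order_charGenerator_odd)
    (hPR : perrinRiou_rankOne_leadingTerms_odd) (hMT : mazur_tate_sigma_exists_odd)
    (hmod : nonempty_modularParametrizationData) (hmod' : hasEntireLFunction_rat)
    (hGZK : rank_eq_analyticRank_of_analyticRank_le_one) (hCassels : bsdRHS_eq_of_isIsogenous)
    (h : Leaf W p) {N : ℕ} [NeZero N] (f : CuspForm (Gamma0 N) 2) (hf : IsNewformOf W f) {C : ℝ}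
    (hC : ∀ (m : ℕ) (a : ZMod (p ^ m)), ‖msdMeasure f (unitRoot W p : ℚ_[p]) m a‖ ≤ C) {n : ℕ}
    (hlt : C * (p : ℝ) ^ (-n : ℤ) < ‖padicLRiemannSum f (unitRoot W p : ℚ_[p]) 1 n‖)
    {W' : WeierstrassCurve ℚ} [W'.IsElliptic] [W'.IsGloballyMinimal] (hiso : IsIsogenous W W')
    (hunit : ∃ q : ℚ, shaAn W' = (q : ℂ) ∧ padicValRat p q = 0) : BSDp W p :=
  h.bsdp_of_coeff_one_ne_zero_of_isIsogenous_shaAn_unit hW16 hS hPR hMT hmod hmod' hGZK hCassels f hf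
    (coeff_one_padicLFunction_ne_zero_of_riemannSum_certificate h.isOrdinaryAt hf hC hlt) hiso hunit

end Summit.BirchSwinnertonDyer.Rank1Residual.X1.RankOne

end
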